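import Mathlib
import HarnessLib
import Summits.AtomisticToContinuum.FouriersLaw.Theses.JunctionLocality
import Summits.AtomisticToContinuum.FouriersLaw.Theorems.JunctionLocalitySuperadditiveResistanceDeviceLiouville
import Summits.AtomisticToContinuum.FouriersLaw.Theorems.JunctionLocalitySuperadditiveResistancePlainAdjoint
import Summits.AtomisticToContinuum.FouriersLaw.Theorems.JunctionLocalityConductanceLowerBoundStubKuboLink
import Summits.AtomisticToContinuum.FouriersLaw.Theorems.JunctionLocalityConductanceLowerBoundStubRelocPositiveConductance
import Summits.AtomisticToContinuum.FouriersLaw.Theorems.JunctionLocalityConductanceLowerBoundStubContactFormation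
import Summits.AtomisticToContinuum.FouriersLaw.Theorems.JunctionLocalityConductanceLowerBoundRelocForwardFieldAnchors
import Summits.AtomisticToContinuum.FouriersLaw.Theorems.JunctionLocalityConductanceLowerBoundRelocForwardFieldOfResolventBound
import Summits.AtomisticToContinuum.FouriersLaw.Theorems.JunctionLocalityConductanceLowerBoundRelocCrossLevelAux1
import Summits.AtomisticToContinuum.FouriersLaw.Theorems.JunctionLocalitySuperadditiveResistanceStubDeviceForwardFieldsAux6
import Summits.AtomisticToContinuum.FouriersLaw.Theorems.JunctionLocalitySuperadditiveResistanceStubPlainForwardField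
import Summits.AtomisticToContinuum.FouriersLaw.Theorems.JunctionLocalityConductanceLowerBoundStubRelocPositiveConductanceResolvent
import Summits.AtomisticToContinuum.FouriersLaw.Theorems.JunctionLocalityConductanceLowerBoundStubContactFormationResolvent
import Summits.AtomisticToContinuum.FouriersLaw.Theorems.JunctionLocalityConductanceLowerBoundStubKuboLinkResolvent
import Summits.AtomisticToContinuum.FouriersLaw.Theorems.ConductanceLowerBound.Negative.GammaZeroNonUniqueness
import Summits.AtomisticToContinuum.FouriersLaw.Theorems.ConductanceLowerBound.Negative.HarmonicCornerLowerBound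
import Summits.AtomisticToContinuum.FouriersLaw.Theorems.ConductanceLowerBound.Negative.NotInsulatorReduction

/-!
# Line `cold-bath-relocation-walk` — checked skeleton for the crux `JunctionLocality.ConductanceLowerBound`
(lead prover-line-stmt-AtomisticToContinuum-11749-c2-0, skeleton v5 — RESOLVENT FRAME (v5: R3λ, R4λ, ENDλ LANDED; the ONLY sorry is the bet R5λ `stub_bulkStep_resolvent`): the walk is run with the resolvent fields
`(λ − L_m)⁻¹ k_0`, which EXIST unconditionally (landed `exists_resolventField`), and `λ → 0` is taken only at the END placement, so the
fixed-`N` debt R1 (network ergodicity for interior `m`) no longer enters the composition; v2: registered stubs restated in TREE vocabulary —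
`liouvilleOp`, `thermo`, `kin`, `gibbsMeasure` — so that workers' `--supports` files need no skeleton definitions;
`stub_kuboLink` (R2) is CLOSED by the landed `ForecastSensitivity.stub_kuboLink`, p95958)
(crux item stmt-AtomisticToContinuum-11749, rank 4, the positivity half `liminf_N D_N > 0`; routes
`route-AtomisticToContinuum-JunctionLocality` (primary), `route-AtomisticToContinuum-StaticAbelianSqueeze`;
idea card `Cruxes/ConductanceLowerBound/Ideas/cold-bath-relocation-walk.md`, triage TRIAGE-r1-1 / r1-2: pass, pass)

Crux (FIXED, concluded BY NAME in §3): along unique weak steady-state families of `pinnedChain ω₂ lam β γ`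
(all `> 0`), for every `T > 0` and response coefficients `D_N`: `∃ c > 0 ∃ N₁ ∀ N ≥ N₁, c ≤ D_N`.

## The line, in the equilibrium (Kubo) frame

Keep ONE `L`-site Hamiltonian `H` and ONE measure, the Gibbs state `μ_T`, and move only the COLD thermostat:
`L_m := X_H + γ S_{B_m}`, `S_B f = Σ_i B_i (T ∂²_{p_i} f − p_i ∂_{p_i} f)` (landed `liouvilleOp`, `bathOp`), with
site weights `B_m = 𝟙_{i=0} + 𝟙_{i=m}` (`relocWeight`): hot bath on site `0`, cold bath on site `m`, sites
`m+1, …, L−1` a passive unthermostatted tail; `m = L−1` is the plain chain (`relocOp_end`), `m = 0` puts both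
baths on site `0`.  The relocated FORWARD FIELD `g_m` is the classical mean-zero `C² ∩ L²(μ_T)` solution of
`L_m g = −(p_0² − T)` (`relocForwardFields`; unique by the LANDED `L²(μ_T)`-Liouville theorem —
`relocForwardField_unique` below, sorry-free), and the relocated CONDUCTANCE is the Kubo functional
`G_L(m) := γ (1 − γ ⟨g_m, p_0² − T⟩_{μ_T} / T²)` (`relocConductance`; Rey-Bellet 2003 Rem. 4.4 /
Kundu–Dhar–Narayan 2009: the two-terminal linear-response conductance of the chain with the cold bath on site `m`).
Two exact facts frame a walk in `m`:
* ANCHOR (`m = 0`, not load-bearing in this cut): `L_0 H = −2γ (p_0² − T)`, so `g_0 = (H − ⟨H⟩)/(2γ)` and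
  `G_L(0) = γ/2` EXACTLY at every `L` (Gaussian fourth moment `Cov_{μ_T}(H, p_0²) = T²`);
* END (`m = L−1`): `D_L/(L−1) = G_L(L−1)` — the finite-volume Kubo formula for the crux's response coefficient
  (`stub_kuboLink`, fixed `N`, SHARED verbatim with line `ForecastSensitivitySketch` and with crux 11748's
  `stub_plainKuboLink`).
Hence `liminf_N D_N > 0` follows from a UNIFORM-IN-THE-TAIL floor on the adjacent-contact device
(`stub_contactFormation`: `G_L(1) ≥ c₀`, the anchor plus the first relocation step) and BOUNDED ONE-SITE
RELOCATION RESISTANCE in the bulk (`stub_bulkStep`: `1/G_L(m+1) − 1/G_L(m) ≤ C` for `1 ≤ m ≤ L−2`, typed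
division-free as `G_L(m) − G_L(m+1) ≤ C·G_L(m)·G_L(m+1)`), via the sorry-free real-variable walk
`walk_lower_bound`: `G_L(m) ≥ 1/(1/c₀ + C(m−1))`, so `D_L = (L−1) G_L(L−1) ≥ 1/(1/c₀ + C)` for EVERY `L ≥ 2`
(an explicit Ohm slope, `N₁ = 2`).  Consecutive operators differ by the pure dissipation relocation
`γ(S_{𝟙_{m+1}} − S_{𝟙_m})` on the same `L²(μ_T)`, so the second resolvent identity gives the prover's arena
`⟨g_{m+1} − g_m, k_0⟩ = −γT[⟨∂_{p_{m+1}} g_m, ∂_{p_{m+1}} ĝ_{m+1}⟩ − ⟨∂_{p_m} g_m, ∂_{p_m} ĝ_{m+1}⟩]`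
(`ĝ = g∘Θ` the backward field), cf. the card.

## Registered stubs (5) and the composition

* `stub_relocForwardField` (R1, fixed `N`, size L) — existence of the relocated forward field for every `m < L`.
* `stub_kuboLink` (R2, fixed `N`, size L; SHARED DEBT, identical signature to `ForecastSensitivity.stub_kuboLink`).
* `stub_relocPositiveConductance` (R3, fixed `N`, size M) — `G_L(m) > 0` (`1 ≤ m < L`).
* `stub_contactFormation` (R4, uniform in the tail length, size L) — `∃ c₀ > 0 ∀ L ≥ 2, G_L(1) ≥ c₀`.
* `stub_bulkStep` (R5, THE BET, uniform in `L` and `m`, size XL) — `∃ C ≥ 0`, `G_L(m) − G_L(m+1) ≤ C G_L(m) G_L(m+1)`.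
* `ConductanceLowerBound_of` — kernel-checked composition concluding the route decl BY NAME.

Disproof.lean (v2.4) honoured: `false_without_steadyFamily` / `false_without_response` are consumed at
`stub_kuboLink` (the only stub that sees `μ` and `D`); `false_without_posTemp` at every stub (`μ_T`, `T > 0`);
§2b `harmonic_corner`: at `lam = β = 0` every stub holds (relocated conductances bounded below, increments of
`1/G` bounded above: kit j006212, j014651, j014636) — `0 < lam`, `0 < β` are carried, idle; §3 / Negative
`GammaZeroNonUniqueness`: every stub has `0 < γ` and at `γ = 0` there is no forward field; Negative
`NotInsulatorReduction` (§4–5 subsequence discount): not used — the bound is uniform; Negative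
`HarmonicCornerLowerBound`: consistent (lower bound only).  The three Negative files are imported here as the
scratch check that nothing below instantiates against them.
-/

noncomputable section

open MeasureTheory Filter Topology
open scoped ContDiff
open Literature.MathematicalPhysics.KineticTheory.HeatConduction
open Summit.AtomisticToContinuum.FouriersLaw.Theorems.SuperadditiveResistance.DeviceLiouville
  (kin thermo liouvilleOp bathOp liouvilleOp_sub bathOp_sub eq_zero_of_liouville_pinnedChain
    generator_eq_liouvilleOp_add thermo_eq_zero_of_le)
open Summit.AtomisticToContinuum.FouriersLaw.Cruxes.SuperadditiveResistance.FloatingProbeBypassLaplacian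
  (exists_resolventField pinnedChain_memLp_two_kin stub_plainForwardField)

namespace Summit.AtomisticToContinuum.FouriersLaw.Cruxes.ConductanceLowerBound.ColdBathRelocationWalk

/-! ## §0 Vocabulary of the walk (equilibrium frame; all objects live on `L²(μ_T)` of ONE `L`-chain)

The registered stubs of §2 do NOT use these definitions (they are spelled out in tree vocabulary:
`L_m g = liouvilleOp P L g + γ (thermo L 0 T g + thermo L m T g)`); the definitions only organise the
composition `ConductanceLowerBound_of`. -/

/-- Site weights of the RELOCATED thermostats: the hot bath on site `0` and the cold bath on site `m`
(`m = L − 1`: the plain chain, `= OscillatorChain.bathWeight L`, see `relocWeight_end`; `m = 0`: both baths on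
site `0`, weight `2`; the sites `m+1, …, L−1` carry no thermostat — the passive tail). -/
def relocWeight (L m : ℕ) (i : Fin L) : ℝ :=
  (if i.val = 0 then 1 else 0) + (if i.val = m then 1 else 0)

/-- The equilibrium generator of the relocated chain, `L_m = X_H + γ (S_0 + S_m)` (all thermostats at `T`),
acting on `C²` observables of the `L`-chain `pinnedChain ω₂ lam β γ`, in tree vocabulary
(`liouvilleOp` = `X_H`, `thermo L s T` = the Ornstein–Uhlenbeck operator `T∂²_{p_s} − p_s∂_{p_s}` of site `s`). -/
def relocOp (ω₂ lam β γ T : ℝ) (L m : ℕ) (g : PhaseSpace L → ℝ) (x : PhaseSpace L) : ℝ :=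
  liouvilleOp (pinnedChain ω₂ lam β γ) L g x + γ * (thermo L 0 T g x + thermo L m T g x)

/-- Relocated forward fields of the HOT contact: classical mean-zero `C² ∩ L²(μ_T)` solutions of
`L_m g = −(p_0² − T)` (cold bath on site `m`).  At `m = L − 1` these are exactly the plain chain's left forward
fields. -/
def relocForwardFields (ω₂ lam β γ T : ℝ) (L m : ℕ) : Set (PhaseSpace L → ℝ) :=
  {g | ContDiff ℝ 2 g ∧ MemLp g 2 ((pinnedChain ω₂ lam β γ).gibbsMeasure L T) ∧
    ∫ x, g x ∂((pinnedChain ω₂ lam β γ).gibbsMeasure L T) = 0 ∧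
    ∀ x, liouvilleOp (pinnedChain ω₂ lam β γ) L g x + γ * (thermo L 0 T g x + thermo L m T g x) =
      -(kin L 0 x - T)}

/-- The escape integral `I[g] = ⟨g, p_0² − T⟩_{μ_T}` (for the forward field of `L_m`:
`∫₀^∞ Cov(p_0²(0), p_0²(t)) dt` under the relocated equilibrium dynamics). -/
def escapeIntegral (ω₂ lam β γ T : ℝ) (L : ℕ) (g : PhaseSpace L → ℝ) : ℝ :=
  ∫ x, g x * (kin L 0 x - T) ∂((pinnedChain ω₂ lam β γ).gibbsMeasure L T)

/-- The Kubo conductance functional `G[g] = γ (1 − γ I[g] / T²)`: for the forward field `g_m` of `L_m` it is the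
two-terminal linear-response conductance `G_L(m)` of the chain with the hot bath on site `0` and the cold bath on
site `m` (Rey-Bellet 2003 Rem. 4.4; Kundu–Dhar–Narayan 2009); `G_L(L−1) = D_L/(L−1)` is `stub_kuboLink`. -/
def relocConductance (ω₂ lam β γ T : ℝ) (L : ℕ) (g : PhaseSpace L → ℝ) : ℝ :=
  γ * (1 - γ / T ^ 2 * escapeIntegral ω₂ lam β γ T L g)

/-! ## §1 Sorry-free structural lemmas: weights ↔ thermostats; end placement = plain chain; uniqueness -/

/-- The weighted bath operator of the relocated weights is the sum of the two single-site thermostats: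
`S_{B_m} = S_{𝟙_0} + S_{𝟙_m}` (as `thermo L 0 T + thermo L m T`). [folklore] -/
theorem bathOp_relocWeight (L m : ℕ) (T : ℝ) (g : PhaseSpace L → ℝ) (x : PhaseSpace L) :
    bathOp L (relocWeight L m) T g x = thermo L 0 T g x + thermo L m T g x := by
  unfold bathOp thermo relocWeight
  rw [← Finset.sum_add_distrib]
  refine Finset.sum_congr rfl fun i _ => ?_
  split_ifs <;> ring

/-- The relocated operator in weighted form: `L_m g = X_H g + γ S_{B_m} g`. [folklore] -/
theorem relocOp_eq_bathOp (ω₂ lam β γ T : ℝ) (L m : ℕ) (g : PhaseSpace L → ℝ) (x : PhaseSpace L) :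
    relocOp ω₂ lam β γ T L m g x =
      liouvilleOp (pinnedChain ω₂ lam β γ) L g x + γ * bathOp L (relocWeight L m) T g x := by
  rw [relocOp, bathOp_relocWeight]

/-- At `m = L − 1` the relocated weights are the plain chain's `bathWeight`. [folklore] -/
theorem relocWeight_end (L : ℕ) : relocWeight L (L - 1) = OscillatorChain.bathWeight L := by
  funext i
  rfl

/-- At `m = L − 1` the relocated equilibrium generator IS the plain generator `L_{T,T}`
(landed `generator_eq_liouvilleOp_add`). [folklore] -/
theorem relocOp_end (ω₂ lam β γ T : ℝ) {L : ℕ} (g : PhaseSpace L → ℝ) (x : PhaseSpace L) :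
    relocOp ω₂ lam β γ T L (L - 1) g x = (pinnedChain ω₂ lam β γ).generator L T T g x := by
  rw [generator_eq_liouvilleOp_add, relocOp_eq_bathOp, relocWeight_end]
  rfl

/-- Membership in `relocForwardFields` unfolds to the four registered hypotheses. [folklore] -/
theorem mem_relocForwardFields_iff {ω₂ lam β γ T : ℝ} {L m : ℕ} {g : PhaseSpace L → ℝ} :
    g ∈ relocForwardFields ω₂ lam β γ T L m ↔
      ContDiff ℝ 2 g ∧ MemLp g 2 ((pinnedChain ω₂ lam β γ).gibbsMeasure L T) ∧
        ∫ x, g x ∂((pinnedChain ω₂ lam β γ).gibbsMeasure L T) = 0 ∧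
        ∀ x, liouvilleOp (pinnedChain ω₂ lam β γ) L g x + γ * (thermo L 0 T g x + thermo L m T g x) =
          -(kin L 0 x - T) :=
  Iff.rfl

/-- A relocated forward field at the end placement satisfies the four hypotheses of `stub_kuboLink`
(the plain chain's left forward field). [folklore] -/
theorem plain_of_mem_relocForwardFields_end {ω₂ lam β γ T : ℝ} {L : ℕ} {g : PhaseSpace L → ℝ}
    (hg : g ∈ relocForwardFields ω₂ lam β γ T L (L - 1)) :
    ContDiff ℝ 2 g ∧ MemLp g 2 ((pinnedChain ω₂ lam β γ).gibbsMeasure L T) ∧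
      ∫ x, g x ∂((pinnedChain ω₂ lam β γ).gibbsMeasure L T) = 0 ∧
      ∀ x, (pinnedChain ω₂ lam β γ).generator L T T g x = -(kin L 0 x - T) := by
  obtain ⟨hC, hL2, hmean, hpde⟩ := hg
  refine ⟨hC, hL2, hmean, fun x => ?_⟩
  rw [← relocOp_end]
  exact hpde x

/-- The relocated weights are non-negative. [folklore] -/
theorem relocWeight_nonneg (L m : ℕ) (i : Fin L) : 0 ≤ relocWeight L m i := by
  unfold relocWeight
  split_ifs <;> norm_num

/-- The relocated weights charge site `0` (the hot bath never moves). [folklore] -/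
theorem relocWeight_pos_zero {L : ℕ} (hL : 0 < L) (m : ℕ) : 0 < relocWeight L m ⟨0, hL⟩ := by
  have h0 : ((⟨0, hL⟩ : Fin L).val = 0) := rfl
  unfold relocWeight
  rw [if_pos h0]
  split_ifs <;> norm_num

/-- **Uniqueness of relocated forward fields** (answers triage objection r1-1 (1) / r1-2: the stubs below quantify
over solutions of `L_m g = −(p_0² − T)`, a set with AT MOST ONE element).  Two classical mean-zero `C² ∩ L²(μ_T)`
solutions coincide: their difference solves `X_H w + γ S_{B_m} w = 0`, and the landed `L²(μ_T)`-Liouville theorem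
`eq_zero_of_liouville_pinnedChain` (any site weights `B ≥ 0` charging site `0`) kills it. [folklore] -/
theorem relocForwardField_unique {ω₂ lam β γ T : ℝ} (hω : 0 < ω₂) (hl : 0 ≤ lam) (hβ : 0 ≤ β)
    (hγ : 0 < γ) (hT : 0 < T) {L m : ℕ} (hL : 0 < L) {g g' : PhaseSpace L → ℝ}
    (hg : g ∈ relocForwardFields ω₂ lam β γ T L m) (hg' : g' ∈ relocForwardFields ω₂ lam β γ T L m) :
    g = g' := by
  obtain ⟨hC, hL2, hmean, hpde⟩ := hg
  obtain ⟨hC', hL2', hmean', hpde'⟩ := hg'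
  have hwC : ContDiff ℝ 2 (fun y => g y - g' y) := hC.sub hC'
  have hwL2 : MemLp (fun y => g y - g' y) 2 ((pinnedChain ω₂ lam β γ).gibbsMeasure L T) :=
    hL2.sub hL2'
  haveI := pinnedChain_isProbabilityMeasure_gibbsMeasure hω hl hβ γ L hT
  have hwmean : ∫ x, (fun y => g y - g' y) x ∂((pinnedChain ω₂ lam β γ).gibbsMeasure L T) = 0 := by
    simp only
    rw [integral_sub (hL2.integrable one_le_two) (hL2'.integrable one_le_two), hmean, hmean', sub_zero]
  have hwpde : ∀ x, 1 * liouvilleOp (pinnedChain ω₂ lam β γ) L (fun y => g y - g' y) x +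
      γ * bathOp L (relocWeight L m) T (fun y => g y - g' y) x = 0 := by
    intro x
    have e := hpde x
    have e' := hpde' x
    rw [← bathOp_relocWeight] at e e'
    rw [one_mul, liouvilleOp_sub (hC.differentiable two_ne_zero) (hC'.differentiable two_ne_zero),
      bathOp_sub hC hC']
    linear_combination e - e'
  have hzero := eq_zero_of_liouville_pinnedChain hω hl hβ γ hL hT (relocWeight L m)
    (relocWeight_nonneg L m) (relocWeight_pos_zero hL m) one_ne_zero hγ hwC hwL2 hwpde hwmean
  funext y
  exact sub_eq_zero.mp (hzero y)

/-! ## §2 Resolvent fields exist unconditionally (sorry-free; this is what removes R1 from the composition) -/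

/-- **Relocated RESOLVENT fields exist** for every `λ > 0`, every `L ≥ 1` and every cold-bath position `m` (any `m`; for
`m ≥ L` the second thermostat is void): a smooth `u ∈ L²(μ_T)` with `λu − (X_H u + γ(S_0 + S_m)u) = p_0² − T` pointwise — the
landed essential m-dissipativity `exists_resolventField` (general weights `B ≥ 0` with `B_0 > 0`) for `B = 𝟙_0 + 𝟙_m`.  No ergodicity,
no rate, no network Harris theorem. [folklore] -/
theorem relocResolventField_exists {ω₂ lam β γ T : ℝ} (hω : 0 < ω₂) (hl : 0 ≤ lam) (hβ : 0 ≤ β) (hγ : 0 < γ)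
    (hT : 0 < T) {L : ℕ} (hL : 0 < L) (m : ℕ) {l : ℝ} (hlpos : 0 < l) :
    ∃ u : PhaseSpace L → ℝ, ContDiff ℝ 2 u ∧ MemLp u 2 ((pinnedChain ω₂ lam β γ).gibbsMeasure L T) ∧
      ∀ x, l * u x - (liouvilleOp (pinnedChain ω₂ lam β γ) L u x + γ * (thermo L 0 T u x + thermo L m T u x)) =
        kin L 0 x - T := by
  have hks : ContDiff ℝ ∞ (fun x : PhaseSpace L => kin L 0 x - T) := contDiff_kin_sub_const L 0 T
  haveI := pinnedChain_isProbabilityMeasure_gibbsMeasure hω hl hβ γ L hT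
  have hk2 : MemLp (fun x : PhaseSpace L => kin L 0 x - T) 2 ((pinnedChain ω₂ lam β γ).gibbsMeasure L T) :=
    (pinnedChain_memLp_two_kin hω hl hβ γ L 0 hT).sub (memLp_const T)
  obtain ⟨u, huC, hu2, hpde⟩ := exists_resolventField hω hl hβ γ hL hT one_ne_zero hγ
    (B := relocWeight L m) (relocWeight_nonneg L m) (relocWeight_pos_zero hL m) hlpos hks hk2
  refine ⟨u, huC.of_le (by norm_cast), hu2, fun x => ?_⟩
  have e := hpde x
  rw [one_mul, bathOp_relocWeight] at e
  exact e

/-! ## §3 The registered stubs of the resolvent frame (tree vocabulary only)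

History.  v2/v3 registered the `λ = 0` stubs R1 `stub_relocForwardField` (existence of relocated forward fields — OPEN for interior `m`:
needs CEHR-2018 network ergodicity, not in tree; anchors and the resolvent-bound reductions landed p129302/p129473/p129568), R3
`stub_relocPositiveConductance` (LANDED p129651), R4 `stub_contactFormation` (LANDED p130620, the curl certificate) and R5 `stub_bulkStep`
(the bet).  v4 keeps their landed files imported and re-registers the three walk inputs for the RESOLVENT fields
`u^λ_m = (λ − L_m)⁻¹ k_0`, `λ > 0`, which exist unconditionally (§2); `λ → 0` is taken once, at the end placement `m = L−1`, against the
plain chain's forward field (landed existence `stub_plainForwardField` + landed `stub_kuboLink`).  The conductance functional is unchanged: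
`G[u] = γ(1 − γ⟨u, k_0⟩/T²)`. -/

/-- **R2 — KUBO LINK (fixed `N`): CLOSED** by the landed `ForecastSensitivity.stub_kuboLink` (p95958, identical signature).  Under the
crux's hypotheses, for every `L ≥ 2` and every classical mean-zero `C² ∩ L²(μ_T)` solution `g` of `L_{T,T} g = −(p_0² − T)`:
`D_L/(L−1) = γ(1 − (γ/T²)⟨g, p_0² − T⟩_{μ_T})`.  In this line it is the END of the walk. -/
theorem stub_kuboLink :
    ∀ (ω₂ lam β γ : ℝ) (μ : (N : ℕ) → ℝ → ℝ → Measure (PhaseSpace N)) (T : ℝ) (D : ℕ → ℝ),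
      0 < ω₂ → 0 < lam → 0 < β → 0 < γ → 0 < T →
      (∀ (N : ℕ) (T_L T_R : ℝ), 0 < T_L → 0 < T_R → ∀ ρ ρ' : Measure (PhaseSpace N),
        (pinnedChain ω₂ lam β γ).IsSteadyState N T_L T_R ρ →
        (pinnedChain ω₂ lam β γ).IsSteadyState N T_L T_R ρ' → ρ = ρ') →
      (∀ (N : ℕ) (T_L T_R : ℝ), 0 < T_L → 0 < T_R →
        (pinnedChain ω₂ lam β γ).IsSteadyState N T_L T_R (μ N T_L T_R)) →
      (∀ N : ℕ, Tendsto (fun δ : ℝ =>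
        (pinnedChain ω₂ lam β γ).totalCurrent (μ N (T + δ / 2) (T - δ / 2)) / δ) (𝓝[≠] 0) (𝓝 (D N))) →
      ∀ L : ℕ, 2 ≤ L → ∀ g : PhaseSpace L → ℝ, ContDiff ℝ 2 g →
        MemLp g 2 ((pinnedChain ω₂ lam β γ).gibbsMeasure L T) →
        ∫ x, g x ∂((pinnedChain ω₂ lam β γ).gibbsMeasure L T) = 0 →
        (∀ x, (pinnedChain ω₂ lam β γ).generator L T T g x = -(kin L 0 x - T)) →
        D L / ((L : ℝ) - 1) =
          γ * (1 - γ / T ^ 2 * ∫ x, g x * (kin L 0 x - T) ∂((pinnedChain ω₂ lam β γ).gibbsMeasure L T)) :=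
  Summit.AtomisticToContinuum.FouriersLaw.Cruxes.ConductanceLowerBound.ForecastSensitivity.stub_kuboLink

/-! **R3λ — RELOCATED RESOLVENT CONDUCTANCES ARE POSITIVE (fixed `N`, size S).**  For every `λ > 0`, `m < L` and every `C² ∩ L²(μ_T)`
solution `u` of `λu − L_m u = k_0`: `G[u] > 0`.  Proof: the weighted Dirichlet identity with source `k_0 − λu` (landed
`integral_mul_source_eq_weightedDirichlet`) gives `s := ⟨u,k_0⟩ = γT(‖∂_0 u‖² + ‖∂_m u‖²) + λ‖u‖²`, and with the Gaussian projection
`⟨p_0, ∂_0 u⟩ = s/T` one gets `T² − γ s = γ²T·Y + γλ‖u‖²`, `Y = ‖p_0/γ − ∂_0 u‖² + ‖∂_m u‖² ≥ 0`; `T² − γs = 0` would force `u = 0`,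
contradicting the equation (`k_0 ≢ 0`).
LANDED: `stub_relocPositiveConductance_resolvent` — Theorems/JunctionLocalityConductanceLowerBoundStubRelocPositiveConductanceResolvent.lean (p131595), imported above. -/

/-! **R4λ — CONTACT FORMATION FOR RESOLVENT FIELDS (`L`-uniform constant, size M given the landed R4 files).**  `∃ c₀ > 0 ∀ L ≥ 2 ∃ λ₀ > 0
∀ λ ∈ (0, λ₀) ∀ u` solving `λu − L_1 u = k_0`: `G[u] ≥ c₀`.  Proof: the curl certificate of R4 verbatim, with two `λ`-corrections —
(i) the transmission form becomes the INEQUALITY `G[u] ≥ (γ³/T)Y_λ` (extra `+γλ‖u‖²`), (ii) the cross identity acquires `−λ⟨φ, u⟩`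
(`φ = p_0F_1 − p_1F_0`), i.e. `Γ_λ = Γ + (λ/T)⟨φ,u⟩` with `Γ = (T/γ)E[V''(q_1−q_0)] ≥ T/γ`; and `λ⟨u^λ, φ⟩ → 0` as `λ → 0` at FIXED `L` by the
mean-ergodic lemma for `L_1` on `L²(μ_T)` (`λ(λ − L_1)⁻¹ → projection on constants`, weakly: Banach–Alaoglu cluster points are weak
solutions of `L_1^† v = 0`, hence classical (landed Hörmander regularity) and constant (landed Liouville theorem); `⟨k_0⟩ = 0`).  So for
`λ < λ₀(L)`: `Y_λ ≥ Γ²/(4D)`, `G ≥ γT/(4D) =: c₀` with the `L`-uniform `D` of the landed Moments file.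
LANDED: `stub_contactFormation_resolvent` — Theorems/JunctionLocalityConductanceLowerBoundStubContactFormationResolvent.lean (p132132; helper_relocMeanErgodic p131856, ContactFormationResolventAux1 p131963), imported above. -/

/-! **ENDλ — THE ABELIAN LIMIT AT THE END PLACEMENT (fixed `N`, size M).**  At `m = L−1` the relocated operator is the plain generator
`L_{T,T}` (`relocOp_end`); for its forward field `g` (landed existence, mean zero) and the resolvent fields `u^λ`:
`⟨u^λ, k_0⟩ → ⟨g, k_0⟩` as `λ → 0⁺`.  Proof: `g − u^λ = λ(λ − L)⁻¹ g`, and by the level-`λ` cross identity (landed `integral_cross_eq`)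
`⟨λ(λ−L)⁻¹g, k_0⟩ = λ⟨g, (λ − L^†)⁻¹k_0⟩ → ⟨g⟩⟨k_0⟩ = 0` (mean-ergodic lemma for the backward operator, smooth source `k_0`).
LANDED: `stub_kuboLink_resolvent` — Theorems/JunctionLocalityConductanceLowerBoundStubKuboLinkResolvent.lean (p131939; Aux1 p131783 with relocEnd_meanErgodic / tendsto_resolvent_pairing), imported above. -/

/-- **R5λ — BULK STEP FOR RESOLVENT FIELDS (THE BET; `(L,m)`-uniform constant, `λ₀` may depend on `L`; size XL).**
`∃ C ≥ 0 ∀ L ∃ λ₀ > 0 ∀ λ ∈ (0,λ₀) ∀ 1 ≤ m ≤ L−2`: for the resolvent fields `u = u^λ_m`, `u' = u^λ_{m+1}`,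
`G[u] − G[u'] ≤ C·G[u]·G[u']`.  This is R5 (`stub_bulkStep`) for the `λ`-regularised fields; the landed arena
(`helper_relocIncrementIdentity`) holds verbatim with sources `k_0 − λu`, `k_0 − λû'`.  Lead's diagnosis (card lead-c2 §3): the needed
cancellation between the two adjacent bilinear forms is the macroscopic smoothness of the NESS long-range correlation function at the cold
contact — at least crux-sized. -/
theorem stub_bulkStep_resolvent :
    ∀ (ω₂ lam β γ T : ℝ), 0 < ω₂ → 0 < lam → 0 < β → 0 < γ → 0 < T →
      ∃ C : ℝ, 0 ≤ C ∧ ∀ (L : ℕ), ∃ l₀ : ℝ, 0 < l₀ ∧ ∀ (l : ℝ), 0 < l → l < l₀ →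
        ∀ (m : ℕ), 1 ≤ m → m + 2 ≤ L →
        ∀ u : PhaseSpace L → ℝ, ContDiff ℝ 2 u → MemLp u 2 ((pinnedChain ω₂ lam β γ).gibbsMeasure L T) →
          (∀ x, l * u x - (liouvilleOp (pinnedChain ω₂ lam β γ) L u x + γ * (thermo L 0 T u x + thermo L m T u x)) =
            kin L 0 x - T) →
        ∀ u' : PhaseSpace L → ℝ, ContDiff ℝ 2 u' → MemLp u' 2 ((pinnedChain ω₂ lam β γ).gibbsMeasure L T) →
          (∀ x, l * u' x - (liouvilleOp (pinnedChain ω₂ lam β γ) L u' x +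
              γ * (thermo L 0 T u' x + thermo L (m + 1) T u' x)) = kin L 0 x - T) →
            γ * (1 - γ / T ^ 2 * ∫ x, u x * (kin L 0 x - T) ∂((pinnedChain ω₂ lam β γ).gibbsMeasure L T)) -
                γ * (1 - γ / T ^ 2 * ∫ x, u' x * (kin L 0 x - T) ∂((pinnedChain ω₂ lam β γ).gibbsMeasure L T)) ≤
              C * (γ * (1 - γ / T ^ 2 * ∫ x, u x * (kin L 0 x - T) ∂((pinnedChain ω₂ lam β γ).gibbsMeasure L T))) *
                (γ * (1 - γ / T ^ 2 * ∫ x, u' x * (kin L 0 x - T) ∂((pinnedChain ω₂ lam β γ).gibbsMeasure L T))) := by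
  sorry

/-! ## §4 The walk (pure real analysis, sorry-free) and the composition -/

/-- **The relocation walk, real-variable form**: if `G 1 ≥ c₀ > 0`, `G m > 0` for `1 ≤ m ≤ n`, and
`G m − G (m+1) ≤ C · G m · G (m+1)` for `1 ≤ m < n` (`C ≥ 0`), then `G (1+k) ≥ 1/(1/c₀ + C k)` for
`1 + k ≤ n`: the reciprocal `1/G` grows by at most `C` per step. [folklore] -/
theorem walk_lower_bound {G : ℕ → ℝ} {c₀ C : ℝ} {n : ℕ} (hc₀ : 0 < c₀) (hC : 0 ≤ C)
    (h1 : c₀ ≤ G 1) (hpos : ∀ m, 1 ≤ m → m ≤ n → 0 < G m)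
    (hstep : ∀ m, 1 ≤ m → m + 1 ≤ n → G m - G (m + 1) ≤ C * G m * G (m + 1)) :
    ∀ k : ℕ, 1 + k ≤ n → 1 / (1 / c₀ + C * k) ≤ G (1 + k) := by
  intro k
  induction k with
  | zero =>
    intro _
    simpa using h1
  | succ k ih =>
    intro hk
    have hk' : 1 + k ≤ n := by omega
    have hIH := ih hk'
    set K : ℝ := 1 / c₀ + C * k with hK
    have hKpos : 0 < K := by positivity
    have ha : 0 < G (1 + k) := hpos (1 + k) (by omega) hk'
    have e1 : 1 + (k + 1) = 1 + k + 1 := by omega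
    rw [e1] at hk ⊢
    have hb : 0 < G (1 + k + 1) := hpos (1 + k + 1) (by omega) hk
    have hst : G (1 + k) - G (1 + k + 1) ≤ C * G (1 + k) * G (1 + k + 1) :=
      hstep (1 + k) (by omega) hk
    have haK : 1 ≤ G (1 + k) * K := by rwa [div_le_iff₀ hKpos] at hIH
    have hgoal : 1 ≤ G (1 + k + 1) * (K + C) := by
      have h2 : G (1 + k + 1) ≤ G (1 + k + 1) * (G (1 + k) * K) := le_mul_of_one_le_right hb.le haK
      have key : G (1 + k) * 1 ≤ G (1 + k) * (G (1 + k + 1) * (K + C)) := by nlinarith [h2, hst]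
      exact le_of_mul_le_mul_left key ha
    have hKC : 0 < K + C := by positivity
    have hden : (1 / c₀ + C * ((k + 1 : ℕ) : ℝ)) = K + C := by
      rw [hK]
      push_cast
      ring
    rw [hden, div_le_iff₀ hKC]
    exact hgoal

/-- **COMPOSITION (resolvent frame) — R3λ, R4λ, R5λ, ENDλ prove the crux BY NAME; no existence debt.**  Fix `L ≥ 2` and `ε > 0`;
choose `λ` below the three thresholds `λ₀(L)` of R4λ, R5λ, ENDλ; resolvent fields `u^λ_m` exist for every `m` (§2); R4λ, R3λ, R5λ
feed `walk_lower_bound`, so `G[u^λ_{L−1}] ≥ 1/(1/c₀ + C(L−2))`; ENDλ moves this to the plain forward field `g` (landed existence) up to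
`(γ²/T²)ε`, and the landed Kubo link reads `D_L/(L−1) = G[g]`; `ε → 0` and `(L−1)/(1/c₀ + C(L−2)) ≥ 1/(1/c₀ + C)` finish. -/
theorem ConductanceLowerBound_of :
    Summit.AtomisticToContinuum.FouriersLaw.Theses.JunctionLocality.ConductanceLowerBound := by
  intro ω₂ lam β γ hω hl hβ hγ huniq μ hμ T hT D hD
  obtain ⟨c₀, hc₀, hcontact⟩ := stub_contactFormation_resolvent ω₂ lam β γ T hω hl hβ hγ hT
  obtain ⟨C, hC, hbulk⟩ := stub_bulkStep_resolvent ω₂ lam β γ T hω hl hβ hγ hT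
  refine ⟨1 / (1 / c₀ + C), by positivity, 2, fun L hL => ?_⟩
  have hL0 : 0 < L := by omega
  set P := pinnedChain ω₂ lam β γ with hP
  -- the plain forward field at the end placement and the Kubo link
  obtain ⟨g, hgC, hgL2, hgmean, hgen⟩ :=
    stub_plainForwardField ω₂ lam β γ T hω hl hβ hγ hT L hL
  have hkubo := stub_kuboLink ω₂ lam β γ μ T D hω hl hβ hγ hT huniq hμ hD L hL g hgC hgL2 hgmean hgen
  set Gg : ℝ := γ * (1 - γ / T ^ 2 * ∫ x, g x * (kin L 0 x - T) ∂(P.gibbsMeasure L T)) with hGg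
  have hkubo' : D L / ((L : ℝ) - 1) = Gg := hkubo
  -- thresholds
  obtain ⟨l₄, hl₄, h4⟩ := hcontact L hL
  obtain ⟨l₅, hl₅, h5⟩ := hbulk L
  -- the walk bound transferred to `Gg` up to an arbitrary `ε`
  have hmain : ∀ ε : ℝ, 0 < ε → 1 / (1 / c₀ + C * ((L : ℝ) - 2)) ≤ Gg + γ * (γ / T ^ 2) * ε := by
    intro ε hε
    obtain ⟨lE, hlE, hE⟩ := stub_kuboLink_resolvent ω₂ lam β γ T hω hl hβ hγ hT L hL ε hε
    set l : ℝ := min (min l₄ l₅) lE / 2 with hldef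
    have hlpos : 0 < l := by
      have : 0 < min (min l₄ l₅) lE := lt_min (lt_min hl₄ hl₅) hlE
      rw [hldef]; linarith
    have hl4' : l < l₄ := by
      have : min (min l₄ l₅) lE ≤ l₄ := le_trans (min_le_left _ _) (min_le_left _ _)
      rw [hldef]; linarith
    have hl5' : l < l₅ := by
      have : min (min l₄ l₅) lE ≤ l₅ := le_trans (min_le_left _ _) (min_le_right _ _)
      rw [hldef]; linarith
    have hlE' : l < lE := by
      have : min (min l₄ l₅) lE ≤ lE := min_le_right _ _
      rw [hldef]; linarith
    -- resolvent fields at every cold-bath position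
    have hex : ∀ m : ℕ, ∃ u : PhaseSpace L → ℝ, ContDiff ℝ 2 u ∧ MemLp u 2 (P.gibbsMeasure L T) ∧
        ∀ x, l * u x - (liouvilleOp P L u x + γ * (thermo L 0 T u x + thermo L m T u x)) = kin L 0 x - T :=
      fun m => relocResolventField_exists hω hl.le hβ.le hγ hT hL0 m hlpos
    choose u hu using hex
    set G : ℕ → ℝ := fun m => γ * (1 - γ / T ^ 2 * ∫ x, u m x * (kin L 0 x - T) ∂(P.gibbsMeasure L T)) with hGdef
    have hGm : ∀ m, G m = γ * (1 - γ / T ^ 2 * ∫ x, u m x * (kin L 0 x - T) ∂(P.gibbsMeasure L T)) :=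
      fun m => rfl
    have hG1 : c₀ ≤ G 1 := by
      obtain ⟨h1, h2, h3⟩ := hu 1
      rw [hGm]; exact h4 l hlpos hl4' (u 1) h1 h2 h3
    have hGpos : ∀ m, 1 ≤ m → m ≤ L - 1 → 0 < G m := fun m _ hm2 => by
      obtain ⟨h1, h2, h3⟩ := hu m
      rw [hGm]
      exact stub_relocPositiveConductance_resolvent ω₂ lam β γ T hω hl hβ hγ hT L m (by omega) l hlpos (u m) h1 h2 h3
    have hGstep : ∀ m, 1 ≤ m → m + 1 ≤ L - 1 → G m - G (m + 1) ≤ C * G m * G (m + 1) := fun m hm1 hm2 => by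
      obtain ⟨h1, h2, h3⟩ := hu m
      obtain ⟨h1', h2', h3'⟩ := hu (m + 1)
      rw [hGm, hGm]
      exact h5 l hlpos hl5' m hm1 (by omega) (u m) h1 h2 h3 (u (m + 1)) h1' h2' h3'
    have hwalk := walk_lower_bound hc₀ hC hG1 hGpos hGstep (L - 2) (by omega)
    have hLm : 1 + (L - 2) = L - 1 := by omega
    rw [hLm] at hwalk
    have hcast : ((L - 2 : ℕ) : ℝ) = (L : ℝ) - 2 := by
      rw [Nat.cast_sub hL]; norm_num
    rw [hcast] at hwalk
    -- move to the plain forward field: |S[u_{L-1}] − S[g]| < ε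
    obtain ⟨h1, h2, h3⟩ := hu (L - 1)
    have hend := hE l hlpos hlE' (u (L - 1)) h1 h2 h3 g hgC hgL2 hgmean hgen
    have hGL : G (L - 1) ≤ Gg + γ * (γ / T ^ 2) * ε := by
      rw [hGm, hGg]
      have hab := (abs_lt.mp hend)
      have hγ2 : 0 ≤ γ * (γ / T ^ 2) := by positivity
      nlinarith [hab.1, hab.2, hγ2]
    exact le_trans hwalk hGL
  -- `ε → 0`
  have hbound : 1 / (1 / c₀ + C * ((L : ℝ) - 2)) ≤ Gg := by
    refine le_of_forall_pos_le_add fun ε' hε' => ?_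
    have hγ2 : 0 < γ * (γ / T ^ 2) := by positivity
    have h := hmain (ε' / (γ * (γ / T ^ 2))) (by positivity)
    have heq : γ * (γ / T ^ 2) * (ε' / (γ * (γ / T ^ 2))) = ε' := by field_simp
    linarith [h, heq.le, heq.ge]
  -- arithmetic: `D_L = (L−1)·Gg ≥ (L−1)/(1/c₀ + C(L−2)) ≥ 1/(1/c₀ + C)`
  have hL2r : (2 : ℝ) ≤ (L : ℝ) := by exact_mod_cast hL
  have hL1 : (0 : ℝ) < (L : ℝ) - 1 := by linarith
  have hDL : D L = Gg * ((L : ℝ) - 1) := (div_eq_iff hL1.ne').mp hkubo'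
  set e : ℝ := 1 / c₀ with he_def
  have he : 0 < e := by positivity
  have hK : 0 < e + C * ((L : ℝ) - 2) := by
    have : (0 : ℝ) ≤ C * ((L : ℝ) - 2) := mul_nonneg hC (by linarith)
    linarith
  rw [hDL]
  calc 1 / (e + C) ≤ 1 / (e + C * ((L : ℝ) - 2)) * ((L : ℝ) - 1) := by
        rw [div_mul_eq_mul_div, one_mul, le_div_iff₀ hK, div_mul_eq_mul_div, one_mul,
          div_le_iff₀ (by positivity : (0 : ℝ) < e + C)]
        nlinarith [mul_nonneg he.le (show (0 : ℝ) ≤ (L : ℝ) - 2 by linarith), hC]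
    _ ≤ Gg * ((L : ℝ) - 1) := mul_le_mul_of_nonneg_right hbound hL1.le

end Summit.AtomisticToContinuum.FouriersLaw.Cruxes.ConductanceLowerBound.ColdBathRelocationWalk

end
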